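import Summits.Langlands.Langlands.Theses.EisensteinGelfandKirillov
import Literature.NumberTheory.Automorphic.ThorneQInfinityModular
import Literature.NumberTheory.Automorphic.GLnAdelicStructureProofs
import Literature.NumberTheory.NumberFields.DiscrDvdOfIsSquare
import HarnessLib

/-!
# Route EisensteinGelfandKirillov — `SectorComplement` (stmt-Langlands-18275): a populated corner of the
EISENSTEIN REGION in tree vocabulary — elliptic curves with good reduction above an unramified `5`
(line `Sketch-18275-r1-k1`, idea `eisenstein-entry`, card §P3; `--supports` file; no definitions)

Over a totally real field `K` with `5 ∤ disc K`, let `E / 𝓞 K` (`Δ(E) ≠ 0`) have good reduction above `5`.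
By Thorne 2019 Thm. 2 (= Thorne 2016 Thm. 7.6; tree named fact `Thorne2019_thm2_five`, which asks
`√5 ∉ K` — supplied by the landed bridge `not_isSquare_five_of_not_dvd_discr`, p143092) `E` is modular as soon
as `ρ̄_{E,5}` is IRREDUCIBLE.  In the REDUCIBLE case (a `K`-rational `5`-isogeny) the `5`-adic Tate module of
`E` is a member of the route target's sector `Σ_X` — irreducible (Faltings + no CM over a totally real field,
CM curves being modular by definition), totally odd, unramified outside `5Δ`, upper-triangular integral model
from the isogeny filtration, `5`-distinguished at `v ∣ 5` automatically (good reduction at an unramified place: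
inertia characters `{ω, 1}` / `{ω₂, ω₂⁵}`), crystalline with labelled weights `{0, 1}` — and any L-algebraic
cuspidal `π` Satake–Frobenius compatible with it a.e. makes `E` modular (half-twist to weight zero).  That
package of printed facts about Tate modules is NOT in the tree; it enters here as ONE explicit hypothesis
(`hP`, written out, every clause a theorem in print: Serre 1972 §1.11–1.12, Faltings 1983, FLS 2015 §2), so
the theorem below is a CONDITIONAL glue statement and says exactly what `X` buys:

* `isModularEllipticCurve_goodAboveFive_of_reducibleCrystallineModular` — `X` + Thorne 2019 Thm. 2 + the
  Tate-module package ⇒ EVERY elliptic curve with good reduction above `5` over EVERY totally real field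
  unramified at `5` is modular (open in print for `[K:ℚ] ≥ 6`; known `[K:ℚ] ≤ 3` FLS/DNS, quartic `K ∌ √5`
  Box 2022).  The case split is on (ir)reducibility of `ρ̄_{E,5}`; `X` is used exactly in the reducible
  branch — the Eisenstein entry.

References: J. Thorne, J. EMS 21 (2019), Thm. 2 [Thorne2019]; N. Freitas, B. Le Hung, S. Siksek, Invent. Math.
201 (2015), Thm. 7 and §2 [FreitasLeHungSiksek2015]; J.-P. Serre, Invent. Math. 15 (1972), §1.11–1.12
[Serre1972]; C. Skinner, A. Wiles, Publ. IHÉS 89 (1999), Thm. A [SkinnerWiles1999].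
-/

noncomputable section

set_option linter.dupNamespace false -- project-wide option; `Summit.Langlands.Langlands` is the mandated namespace

open scoped NumberField Classical
open Filter IsDedekindDomain
open Literature.NumberTheory.Automorphic Literature.NumberTheory.GaloisRepresentations
open Summit.Langlands
open Summit.Langlands.Langlands.Theses.EisensteinGelfandKirillov (ReducibleCrystallineModular)

namespace Summit.Langlands.Langlands.Theorems.EisensteinEntry

/-- `Fact (Nat.Prime 5)`, for the `5`-adic coefficient field `PadicAlgCl 5`. [folklore] -/
instance factPrimeFive : Fact (Nat.Prime 5) := ⟨by norm_num⟩

/-- **`X` ⇒ modularity of every elliptic curve with good reduction above an unramified `5` over every totally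
real field**, conditionally on Thorne 2019 Thm. 2 (tree named fact `Thorne2019_thm2_five`) and on the
Tate-module package `hP` (written out; every clause a theorem in print): for `E / 𝓞 K` with `Δ(E) ≠ 0`, good
reduction above `5`, `K` totally real with `5 ∤ disc K` — if `ρ̄_{E,5}` is irreducible, Thorne applies
(`√5 ∉ K` by `not_isSquare_five_of_not_dvd_discr`); if it is reducible, `hP` puts the `5`-adic Tate module in
the sector `Σ_X` (or declares `E` CM-modular) and `X` supplies the cuspidal `π`.
[cite: Thorne2019, Thm. 2] [cite: FreitasLeHungSiksek2015, §2] [cite: Serre1972, §1.11–1.12] -/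
theorem isModularEllipticCurve_goodAboveFive_of_reducibleCrystallineModular : Summit.Langlands.Langlands.Theses.EisensteinGelfandKirillov.ReducibleCrystallineModular → Literature.NumberTheory.Automorphic.Thorne2019_thm2_five → (∀ (K : Type) [Field K] [NumberField K], NumberField.IsTotallyReal K → ¬ ((5 : ℤ) ∣ NumberField.discr K) → ∀ E : WeierstrassCurve (NumberField.RingOfIntegers K), E.Δ ≠ 0 → (∀ v : IsDedekindDomain.HeightOneSpectrum (NumberField.RingOfIntegers K), ((5 : ℕ) : NumberField.RingOfIntegers K) ∈ v.asIdeal → E.Δ ∉ v.asIdeal) → ¬ (E.baseChange K).HasIrreducibleModPGaloisRep 5 → Literature.NumberTheory.Automorphic.IsModularEllipticCurve K E ∨ ∃ (ι : PadicAlgCl 5 ≃+* ℂ) (ρ : Literature.NumberTheory.GaloisRepresentations.FramedGaloisRep K (PadicAlgCl 5) 2), (ρ.toGaloisRep.IsIrreducible ∧ ρ.IsOdd ∧ (∀ᶠ v : IsDedekindDomain.HeightOneSpectrum (NumberField.RingOfIntegers K) in cofinite, ρ.IsUnramifiedAt v) ∧ ∃ (O : ValuationSubring (PadicAlgCl 5))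 (_ : O = (Valued.v : Valuation (PadicAlgCl 5) NNReal).valuationSubring) (ρ₀ : Field.absoluteGaloisGroup K →* Matrix.GeneralLinearGroup (Fin 2) O), ρ.HasUpperTriangularIntegralModel ρ₀ ∧ ∀ (v : IsDedekindDomain.HeightOneSpectrum (NumberField.RingOfIntegers K)) (hv : ((5 : ℕ) : NumberField.RingOfIntegers K) ∈ v.asIdeal), Literature.NumberTheory.GaloisRepresentations.IsPDistinguishedAt ρ₀ v ∧ (Literature.NumberTheory.PAdicHodge.fontainePstAdicCompletion v 5 hv).IsCrystallineFramed (ρ.toLocal v) ∧ (letI := (Literature.NumberTheory.PAdicHodge.fontainePstAdicCompletion v 5 hv).algebra; Literature.NumberTheory.GaloisRepresentations.GaloisRep.IsLabelledHodgeTateRegular (Literature.NumberTheory.PAdicHodge.fontainePstAdicCompletion v 5 hv).𝔅 (ρ.toLocal v).toGaloisRep)) ∧ ∀ (hcpt : Literature.NumberTheory.Automorphic.isCompact_glFiniteIntegralLevel 2 K) (π : Literature.NumberTheory.Automorphic.CuspidalAutomorphicRepData 2 K hcpt), π.1.IsLAlgebraic → (∀ᶠ v : IsDedekindDomain.HeightOneSpectrum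 (NumberField.RingOfIntegers K) in cofinite, Summit.Langlands.SatakeFrobCompatibleAt ι π.1 ρ v) → Literature.NumberTheory.Automorphic.IsModularEllipticCurve K E) → ∀ (K : Type) [Field K] [NumberField K], NumberField.IsTotallyReal K → ¬ ((5 : ℤ) ∣ NumberField.discr K) → ∀ E : WeierstrassCurve (NumberField.RingOfIntegers K), E.Δ ≠ 0 → (∀ v : IsDedekindDomain.HeightOneSpectrum (NumberField.RingOfIntegers K), ((5 : ℕ) : NumberField.RingOfIntegers K) ∈ v.asIdeal → E.Δ ∉ v.asIdeal) → Literature.NumberTheory.Automorphic.IsModularEllipticCurve K E := by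
  intro hX hT hP K _ _ hK h5 E hΔ hgood
  by_cases hirr : (E.baseChange K).HasIrreducibleModPGaloisRep 5
  · exact hT K hK (Literature.NumberTheory.NumberFields.not_isSquare_five_of_not_dvd_discr K h5) E hΔ hirr
  · rcases hP K hK h5 E hΔ hgood hirr with hmod | ⟨ι, ρ, ⟨hirrρ, hodd, hur, O, hO, ρ₀, hup, hloc⟩, hbridge⟩
    · exact hmod
    · have hcpt : isCompact_glFiniteIntegralLevel 2 K := isCompact_glFiniteIntegralLevel_holds 2 K
      obtain ⟨π, hL, hπ⟩ := hX K hK 5 (le_refl 5) h5 O hO hcpt ι ρ ρ₀ hirrρ hodd hur hup hloc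
      exact hbridge hcpt π hL hπ

end Summit.Langlands.Langlands.Theorems.EisensteinEntry

end
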